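import Summits.CriticalPhenomena.PercolationContinuityZ3.Theorems.PercNearOneGluingNoHeavyLowerTailKnQuestion8CoefficientwiseCoreClassKernelMixHubClosed
import Summits.CriticalPhenomena.PercolationContinuityZ3.Theorems.PercNearOneGluingNoHeavyLowerTailKnQuestion8CoefficientwiseCoreClassKernelMixHubPathEmbed
import HarnessLib

/-!
# The path lemma, core transport: from the augmented staircase theorem to words (PATH LEMMA of hub-Kleitman, memo §1.6 ⇒ §2.6)

Support file (`--supports stmt-CriticalPhenomena-4575`, closed), prover `prim-cplus-coupling` (gen 51).  No definitions, no notations,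
no named facts, no sorries; standard axioms.  Memo `prim-cplus-coupling/A5-COUPLING-gen51.md` §1.3, §1.6, §2.6.

THE CORE (`hubPath_core`).  Words `ω ⊆ [1, ℓ]` (red edges of the path `w₀ … w_ℓ`), walls `D(ω)` (`…KernelMixHubWalls`), `ℓ ≥ 2`.
Data of the class 𝒞₀ on `{0, …, ℓ}`: staircase column tops `om`, a down-closed cell set `A`, an up-closed cell set `B`, disjoint.
SOURCES `S` and TARGETS `T` by end colours (memo §1.3, the three levels of memo-50 §2.8):
  `S = {BB : D = ∅ ∨ cell(D) ∈ R} ⊔ {RB : cell(D) ∈ A} ⊔ {BR : cell(D) ∈ B}`,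
  `T = {RR : D = ∅ ∨ cell(D) ∈ R} ⊔ {RB : cell(D) ∈ B} ⊔ {BR : cell(D) ∈ A}`     (`cell(D) = (min D, max D)`, `R = {y ≤ om x}`).
CONCLUSION: an injection `Φ : S → T` ALONG HUB MOVES: `Φ ω = ω ∪ [1, a] ∪ [b+1, ℓ]` with `[1, a]` inside the leading blue run and
`[b+1, ℓ]` inside the trailing blue run of `ω` (a prefix fill, a suffix fill, or both).
PROOF: embed `BB ↦ D`, `RB ↦ {0} ∪ D`, `BR ↦ D ∪ {ℓ}` into the even family of `hubStair_matching_closed` (N = ℓ), apply its `σ`, and read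
the double toggle `σE = E △ {a, b}` back as fills via `walls_prefix_fill` / `walls_suffix_fill`; targets embed by `RR ↦ D`, `RB ↦ D ∪ {ℓ}`,
`BR ↦ {0} ∪ D`, which recovers `σE` from `Φ ω` and gives injectivity ('no other double toggles connect the embedded sets' = `A ∩ B = ∅`).
[cite: KozmaNitzan2024, Questions 8–9 (§5.5 p. 36) (context)]
-/

namespace Summit.CriticalPhenomena.PercolationContinuityZ3.Theorems

open Finset
open scoped symmDiff

namespace Coefficientwise

/-- **Path lemma, core transport** (memo gen51 §1.6 + Theorem 1): an injection of the sources into the targets along hub moves,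
for the natural data `om, A, B` of the class 𝒞₀ (see the module docstring for `S`, `T`). [folklore] -/
theorem hubPath_core (ℓ : ℕ) (hℓ : 2 ≤ ℓ) (om : ℕ → ℕ) (A B : Finset (ℕ × ℕ))
    (hom : ∀ x, 1 ≤ x → x ≤ ℓ - 1 → x + 1 ≤ om x ∧ om x ≤ ℓ)
    (hmono : ∀ x y, 1 ≤ x → x ≤ y → y ≤ ℓ - 1 → om x ≤ om y)
    (hAcell : ∀ c ∈ A, 1 ≤ c.1 ∧ c.1 ≤ c.2 ∧ c.2 ≤ ℓ - 1 ∧ c.2 ≤ om c.1)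
    (hAdown : ∀ c ∈ A, ∀ x y, 1 ≤ x → x ≤ c.1 → x ≤ y → y ≤ c.2 → (x, y) ∈ A)
    (hBcell : ∀ c ∈ B, 1 ≤ c.1 ∧ c.1 ≤ c.2 ∧ c.2 ≤ ℓ - 1 ∧ c.2 ≤ om c.1)
    (hBup : ∀ c ∈ B, ∀ x y, c.1 ≤ x → c.2 ≤ y → x ≤ y → y ≤ ℓ - 1 → (x, y) ∈ B)
    (hAB : ∀ c ∈ A, c ∉ B)
    (D : Finset ℕ → Finset ℕ) (hD : ∀ ω, D ω = (Icc 1 (ℓ - 1)).filter (fun k => ¬ (k ∈ ω ↔ k + 1 ∈ ω)))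
    (S T : Finset ℕ → Prop)
    (hS : ∀ ω, S ω ↔ ω ⊆ Icc 1 ℓ ∧
       ((1 ∉ ω ∧ ℓ ∉ ω ∧ (D ω = ∅ ∨ ∃ h : (D ω).Nonempty, (D ω).max' h ≤ om ((D ω).min' h))) ∨
        (1 ∈ ω ∧ ℓ ∉ ω ∧ ∃ h : (D ω).Nonempty, ((D ω).min' h, (D ω).max' h) ∈ A) ∨
        (1 ∉ ω ∧ ℓ ∈ ω ∧ ∃ h : (D ω).Nonempty, ((D ω).min' h, (D ω).max' h) ∈ B)))
    (hT : ∀ ω, T ω ↔ ω ⊆ Icc 1 ℓ ∧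
       ((1 ∈ ω ∧ ℓ ∈ ω ∧ (D ω = ∅ ∨ ∃ h : (D ω).Nonempty, (D ω).max' h ≤ om ((D ω).min' h))) ∨
        (1 ∈ ω ∧ ℓ ∉ ω ∧ ∃ h : (D ω).Nonempty, ((D ω).min' h, (D ω).max' h) ∈ B) ∨
        (1 ∉ ω ∧ ℓ ∈ ω ∧ ∃ h : (D ω).Nonempty, ((D ω).min' h, (D ω).max' h) ∈ A))) :
    ∃ Φ : Finset ℕ → Finset ℕ,
      (∀ ω, S ω → T (Φ ω) ∧ ∃ a b : ℕ, a ≤ b ∧ b ≤ ℓ ∧ Φ ω = ω ∪ Icc 1 a ∪ Icc (b + 1) ℓ ∧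
          (∀ k ∈ ω, a < k) ∧ (∀ k ∈ ω, k ≤ b)) ∧
      (∀ ω ω', S ω → S ω' → Φ ω = Φ ω' → ω = ω') := by
  classical
  have hℓ1 : 1 ≤ ℓ := by omega
  -- the even family of the augmented staircase theorem (N = ℓ) and its injection σ
  obtain ⟨F, hF⟩ : ∃ F : Finset ℕ → Prop, ∀ E, F E ↔ Even E.card ∧
      (E = ∅ ∨
       (0 ∉ E ∧ ℓ ∉ E ∧ (∀ e ∈ E, e ≤ ℓ - 1) ∧ ∃ h : E.Nonempty, E.max' h ≤ om (E.min' h)) ∨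
       (0 ∈ E ∧ ℓ ∉ E ∧ ∃ h : (E.erase 0).Nonempty, ((E.erase 0).min' h, (E.erase 0).max' h) ∈ A) ∨
       (ℓ ∈ E ∧ 0 ∉ E ∧ ∃ h : (E.erase ℓ).Nonempty, ((E.erase ℓ).min' h, (E.erase ℓ).max' h) ∈ B)) :=
    ⟨_, fun _ => Iff.rfl⟩
  obtain ⟨σ, hσF, hσinj, hσmove⟩ := hubStair_matching_closed ℓ hℓ om A B hom hmono hAcell hAdown hBcell hBup F hF
  -- reading the family (…HubPathEmbed)
  have hInner := hubPath_family_inner ℓ om A B F hF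
  have hZero' := hubPath_family_zero ℓ om A B F hF
  have hTop' := hubPath_family_top ℓ om A B F hF
  have hFle := hubPath_family_le ℓ om A B hAcell hBcell F hF
  -- walls
  have hD0 := hubPath_zero_notMem_walls ℓ D hD
  have hDℓ := hubPath_top_notMem_walls ℓ hℓ1 D hD
  have hDle := hubPath_walls_le ℓ D hD
  -- the source embedding
  obtain ⟨emb, hemb⟩ : ∃ emb : Finset ℕ → Finset ℕ, ∀ ω,
      emb ω = if 1 ∈ ω then insert 0 (D ω) else if ℓ ∈ ω then insert ℓ (D ω) else D ω := ⟨_, fun _ => rfl⟩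
  have stepA : ∀ ω, S ω → F (emb ω) := hubPath_emb_family ℓ hℓ om A B F hF D hD S hS emb hemb
  -- choosing the move of σ at each source
  have key : ∀ ω, ∃ q : ℕ × ℕ, S ω →
      (emb ω = ∅ ∧ σ (emb ω) = ∅ ∧ q = (ℓ, ℓ)) ∨
      (q.1 < q.2 ∧ σ (emb ω) = emb ω ∆ {q.1} ∆ {q.2} ∧ (∀ e ∈ emb ω, q.1 ≤ e ∧ e ≤ q.2) ∧
        (∀ e ∈ σ (emb ω), q.1 ≤ e ∧ e ≤ q.2)) := by
    intro ω
    by_cases hSω : S ω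
    · rcases hσmove (emb ω) (stepA ω hSω) with ⟨h1, h2⟩ | ⟨a, b, hab, hσ, hE, hσE⟩
      · exact ⟨(ℓ, ℓ), fun _ => Or.inl ⟨h1, h2, rfl⟩⟩
      · exact ⟨(a, b), fun _ => Or.inr ⟨hab, hσ, hE, hσE⟩⟩
    · exact ⟨(0, 0), fun h => absurd h hSω⟩
  choose q hq using key
  obtain ⟨Φ, hΦ⟩ : ∃ Φ : Finset ℕ → Finset ℕ, ∀ ω, Φ ω = ω ∪ Icc 1 (q ω).1 ∪ Icc ((q ω).2 + 1) ℓ :=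
    ⟨_, fun _ => rfl⟩
  -- the target embedding
  obtain ⟨emb', hemb'⟩ : ∃ f : Finset ℕ → Finset ℕ, ∀ ω,
      f ω = if 1 ∈ ω ∧ ℓ ∈ ω then D ω else if 1 ∈ ω then insert ℓ (D ω) else insert 0 (D ω) := ⟨_, fun _ => rfl⟩
  -- MAIN: every source moves to a target, and the target embedding recovers σ
  have main : ∀ ω, S ω → T (Φ ω) ∧ emb' (Φ ω) = σ (emb ω) ∧ (q ω).1 ≤ (q ω).2 ∧ (q ω).2 ≤ ℓ ∧
      (∀ k ∈ ω, (q ω).1 < k) ∧ (∀ k ∈ ω, k ≤ (q ω).2) := by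
    intro ω hSω
    obtain ⟨hω, hcase⟩ := (hS ω).mp hSω
    have hFE := stepA ω hSω
    have hFσ := hσF _ hFE
    have hωle : ∀ k ∈ ω, k ≤ ℓ := fun k hk => (Finset.mem_Icc.mp (hω hk)).2
    have hωge : ∀ k ∈ ω, 1 ≤ k := fun k hk => (Finset.mem_Icc.mp (hω hk)).1
    have hconst := hubPath_walls_const ℓ D hD
    rcases hq ω hSω with ⟨hE0, hσ0, hqℓ⟩ | ⟨hab, hσ, hE, hσE⟩
    · ------------------------------------------------------------------ all blue ↦ all red
      have hE := hemb ω
      rw [hE0] at hE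
      have h1 : 1 ∉ ω := by
        intro h; rw [if_pos h] at hE; exact Finset.insert_ne_empty _ _ hE.symm
      rw [if_neg h1] at hE
      have hl : ℓ ∉ ω := by
        intro h; rw [if_pos h] at hE; exact Finset.insert_ne_empty _ _ hE.symm
      rw [if_neg hl] at hE
      have hω0 : ω = ∅ := hubPath_eq_empty_of_first_blue ℓ D hD ω hω h1 hE.symm
      have hq1 : (q ω).1 = ℓ := by rw [hqℓ]
      have hq2 : (q ω).2 = ℓ := by rw [hqℓ]
      have hΦω : Φ ω = Icc 1 ℓ := by
        rw [hΦ, hq1, hq2, hω0, Finset.Icc_eq_empty_of_lt (Nat.lt_succ_self ℓ)]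
        simp
      refine ⟨?_, ?_, by omega, by omega, fun k hk => ?_, fun k hk => ?_⟩
      · rw [hT, hΦω]
        refine ⟨Finset.Subset.refl _, Or.inl ⟨?_, ?_, Or.inl hconst.2⟩⟩
        · exact Finset.mem_Icc.mpr ⟨le_refl _, hℓ1⟩
        · exact Finset.mem_Icc.mpr ⟨hℓ1, le_refl _⟩
      · rw [hemb', hΦω, if_pos ⟨Finset.mem_Icc.mpr ⟨le_refl _, hℓ1⟩, Finset.mem_Icc.mpr ⟨hℓ1, le_refl _⟩⟩,
          hconst.2, hσ0]
      · rw [hω0] at hk; simp at hk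
      · rw [hω0] at hk; simp at hk
    · ------------------------------------------------------------------ a genuine double toggle
      -- notation-free names
      have hbℓ : (q ω).2 ≤ ℓ := by
        by_contra hc
        push Not at hc
        have hEle : ∀ e ∈ emb ω, e ≤ ℓ := hFle _ hFE
        have hb : (q ω).2 ∈ σ (emb ω) := by
          rw [hσ, Finset.mem_symmDiff, Finset.mem_symmDiff]
          refine Or.inr ⟨Finset.mem_singleton_self _, ?_⟩
          rintro (⟨h, _⟩ | ⟨h, _⟩)
          · have := hEle _ h; omega
          · rw [Finset.mem_singleton] at h; omega
        have := hFle _ hFσ _ hb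
        omega
      rcases hcase with ⟨h1, hl, hR⟩ | ⟨h1, hl, hA⟩ | ⟨h1, hl, hB⟩
      · ---------------------------------------------------------------- BB source, E = D ω
        have hEeq : emb ω = D ω := by rw [hemb, if_neg h1, if_neg hl]
        rw [hEeq] at hσ hE hσE hFσ ⊢
        -- blue runs
        have hlead : ∀ k ∈ ω, (q ω).1 < k := by
          intro k hk
          have hDn : (D ω).Nonempty := by
            by_contra h0
            rw [Finset.not_nonempty_iff_eq_empty] at h0
            have := hubPath_eq_empty_of_first_blue ℓ D hD ω hω h1 h0
            rw [this] at hk; simp at hk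
          have h₁ := hubPath_lt_of_mem_of_first_blue ℓ D hD ω hω h1 hDn k hk
          have h₂ := (hE _ ((D ω).min'_mem hDn)).1
          omega
        have htrail : ∀ k ∈ ω, k ≤ (q ω).2 := by
          intro k hk
          have hDn : (D ω).Nonempty := by
            by_contra h0
            rw [Finset.not_nonempty_iff_eq_empty] at h0
            have := hubPath_eq_empty_of_first_blue ℓ D hD ω hω h1 h0
            rw [this] at hk; simp at hk
          have h₁ := hubPath_le_of_mem_of_last_blue ℓ D hD ω hω hl hDn k hk
          have h₂ := (hE _ ((D ω).max'_mem hDn)).2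
          omega
        -- elements of σE
        have hσmem : ∀ e ∈ σ (D ω), e ∈ D ω ∨ e = (q ω).1 ∨ e = (q ω).2 := by
          intro e he; rw [hσ] at he; exact hubPath_mem_symmDiff_two _ _ _ _ he
        by_cases ha0 : (q ω).1 = 0
        · by_cases hbl : (q ω).2 = ℓ
          · -- a = 0, b = ℓ : impossible
            exfalso
            have h0 : 0 ∈ σ (D ω) := by
              rw [hσ, Finset.mem_symmDiff, Finset.mem_symmDiff, ha0, hbl]
              refine Or.inl ⟨Or.inr ⟨Finset.mem_singleton_self _, hD0 ω⟩, ?_⟩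
              rw [Finset.mem_singleton]; omega
            have hl' : ℓ ∈ σ (D ω) := by
              rw [hσ, Finset.mem_symmDiff, Finset.mem_symmDiff, ha0, hbl]
              refine Or.inr ⟨Finset.mem_singleton_self _, ?_⟩
              rintro (⟨h, _⟩ | ⟨h, _⟩)
              · exact hDℓ ω h
              · rw [Finset.mem_singleton] at h; omega
            exact (hZero' _ _ hFσ h0 rfl).1 hl'
          · -- a = 0 < b ≤ ℓ - 1 : suffix fill, BB ↦ BR
            have hb1 : 1 ≤ (q ω).2 := by omega
            have hbn : (q ω).2 ≤ ℓ - 1 := by omega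
            have hΦω : Φ ω = ω ∪ Icc ((q ω).2 + 1) ℓ := by
              rw [hΦ, ha0, Finset.Icc_eq_empty_of_lt Nat.zero_lt_one, Finset.union_empty]
            have hwalls : D (Φ ω) = D ω ∆ {(q ω).2} := by
              rw [hΦω]; exact walls_suffix_fill ℓ D hD ω _ hb1 hbn htrail
            have h0σ : 0 ∈ σ (D ω) := by
              rw [hσ, Finset.mem_symmDiff, Finset.mem_symmDiff, ha0]
              refine Or.inl ⟨Or.inr ⟨Finset.mem_singleton_self _, hD0 ω⟩, ?_⟩
              rw [Finset.mem_singleton]; omega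
            have herase : (σ (D ω)).erase 0 = D ω ∆ {(q ω).2} := by
              rw [hσ, ha0]
              ext e
              simp only [Finset.mem_erase, Finset.mem_symmDiff, Finset.mem_singleton]
              constructor
              · rintro ⟨hne, h⟩; tauto
              · intro h
                have hne : e ≠ 0 := by
                  rcases h with ⟨he, _⟩ | ⟨he, _⟩
                  · exact fun h0 => hD0 ω (h0 ▸ he)
                  · omega
                exact ⟨hne, by tauto⟩
            obtain ⟨_, hne, hAσ⟩ := hZero' _ _ hFσ h0σ rfl
            have h1Φ : 1 ∉ Φ ω := by
              rw [hΦω, Finset.mem_union, Finset.mem_Icc]; push Not; exact ⟨h1, fun h => by omega⟩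
            have hlΦ : ℓ ∈ Φ ω := by
              rw [hΦω, Finset.mem_union, Finset.mem_Icc]; exact Or.inr ⟨by omega, le_refl _⟩
            have hΦsub : Φ ω ⊆ Icc 1 ℓ := by
              rw [hΦω]; intro k hk
              rcases Finset.mem_union.mp hk with hk | hk
              · exact hω hk
              · have := Finset.mem_Icc.mp hk; exact Finset.mem_Icc.mpr ⟨by omega, this.2⟩
            refine ⟨?_, ?_, by omega, hbℓ, fun k hk => by have := hωge k hk; omega, htrail⟩
            · rw [hT]
              refine ⟨hΦsub, Or.inr (Or.inr ⟨h1Φ, hlΦ, ?_⟩)⟩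
              rw [hwalls, ← herase]
              exact ⟨hne, hAσ⟩
            · rw [hemb', if_neg (fun h => h1Φ h.1), if_neg h1Φ, hwalls, ← herase, Finset.insert_erase h0σ]
        · by_cases hbl : (q ω).2 = ℓ
          · -- 1 ≤ a, b = ℓ : prefix fill, BB ↦ RB
            have ha1 : 1 ≤ (q ω).1 := by omega
            have han : (q ω).1 ≤ ℓ - 1 := by omega
            have hΦω : Φ ω = ω ∪ Icc 1 (q ω).1 := by
              rw [hΦ, hbl, Finset.Icc_eq_empty_of_lt (Nat.lt_succ_self ℓ), Finset.union_empty]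
            have hwalls : D (Φ ω) = D ω ∆ {(q ω).1} := by
              rw [hΦω]; exact walls_prefix_fill ℓ D hD ω _ ha1 han hlead
            have hnotl : ℓ ∉ D ω ∆ {(q ω).1} := by
              rw [Finset.mem_symmDiff, Finset.mem_singleton]; push Not; exact ⟨fun h => absurd h (hDℓ ω), by omega⟩
            have hσeq : σ (D ω) = insert ℓ (D ω ∆ {(q ω).1}) := by
              rw [hσ, hbl]; exact hub_symmDiff_singleton_eq_insert _ _ hnotl
            have hlσ : ℓ ∈ σ (D ω) := by rw [hσeq]; exact Finset.mem_insert_self _ _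
            obtain ⟨_, hne, hBσ⟩ := hTop' _ (D ω ∆ {(q ω).1}) hFσ hlσ (by rw [hσeq, Finset.erase_insert hnotl])
            have h1Φ : 1 ∈ Φ ω := by
              rw [hΦω, Finset.mem_union, Finset.mem_Icc]; exact Or.inr ⟨le_refl _, ha1⟩
            have hlΦ : ℓ ∉ Φ ω := by
              rw [hΦω, Finset.mem_union, Finset.mem_Icc]; push Not; exact ⟨hl, fun _ => by omega⟩
            have hΦsub : Φ ω ⊆ Icc 1 ℓ := by
              rw [hΦω]; intro k hk
              rcases Finset.mem_union.mp hk with hk | hk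
              · exact hω hk
              · have := Finset.mem_Icc.mp hk; exact Finset.mem_Icc.mpr ⟨this.1, by omega⟩
            refine ⟨?_, ?_, by omega, hbℓ, hlead, fun k hk => by have := hωle k hk; omega⟩
            · rw [hT]
              refine ⟨hΦsub, Or.inr (Or.inl ⟨h1Φ, hlΦ, ?_⟩)⟩
              rw [hwalls]
              exact ⟨hne, hBσ⟩
            · rw [hemb', if_neg (fun h => hlΦ h.2), if_pos h1Φ, hwalls, hσeq]
          · -- 1 ≤ a < b ≤ ℓ - 1 : two-sided fill, BB ↦ RR
            have ha1 : 1 ≤ (q ω).1 := by omega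
            have hbn : (q ω).2 ≤ ℓ - 1 := by omega
            have hΦω : Φ ω = ω ∪ Icc 1 (q ω).1 ∪ Icc ((q ω).2 + 1) ℓ := hΦ ω
            have hwalls : D (Φ ω) = D ω ∆ {(q ω).1} ∆ {(q ω).2} := by
              rw [hΦω]; exact hubPath_walls_two_sided_fill ℓ D hD ω _ _ ha1 hab hbn hlead htrail
            have h0σ : 0 ∉ σ (D ω) := by
              intro h
              rcases hσmem 0 h with h' | h' | h'
              · exact hD0 ω h'
              · omega
              · omega
            have hlσ : ℓ ∉ σ (D ω) := by
              intro h
              rcases hσmem ℓ h with h' | h' | h'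
              · exact hDℓ ω h'
              · omega
              · omega
            have hRσ := hInner _ hFσ h0σ hlσ
            have h1Φ : 1 ∈ Φ ω := by
              rw [hΦω, Finset.mem_union, Finset.mem_union, Finset.mem_Icc]
              exact Or.inl (Or.inr ⟨le_refl _, ha1⟩)
            have hlΦ : ℓ ∈ Φ ω := by
              rw [hΦω, Finset.mem_union, Finset.mem_Icc]; exact Or.inr ⟨by omega, le_refl _⟩
            have hΦsub : Φ ω ⊆ Icc 1 ℓ := by
              rw [hΦω]; intro k hk
              rcases Finset.mem_union.mp hk with hk | hk
              · rcases Finset.mem_union.mp hk with hk | hk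
                · exact hω hk
                · have := Finset.mem_Icc.mp hk; exact Finset.mem_Icc.mpr ⟨this.1, by omega⟩
              · have := Finset.mem_Icc.mp hk; exact Finset.mem_Icc.mpr ⟨by omega, this.2⟩
            refine ⟨?_, ?_, by omega, hbℓ, hlead, htrail⟩
            · rw [hT]
              refine ⟨hΦsub, Or.inl ⟨h1Φ, hlΦ, ?_⟩⟩
              rw [hwalls, ← hσ]
              exact hRσ
            · rw [hemb', if_pos ⟨h1Φ, hlΦ⟩, hwalls, hσ]
      · ---------------------------------------------------------------- RB source, E = {0} ∪ D ω
        have hEeq : emb ω = insert 0 (D ω) := by rw [hemb, if_pos h1]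
        rw [hEeq] at hσ hE hσE hFσ ⊢
        obtain ⟨hDn, hAc⟩ := hA
        have ha0 : (q ω).1 = 0 := by
          have := (hE 0 (Finset.mem_insert_self _ _)).1; omega
        have hσeq : σ (insert 0 (D ω)) = D ω ∆ {(q ω).2} := by
          rw [hσ, ha0, hubPath_insert_symmDiff_self _ _ (hD0 ω)]
        -- b = ℓ is impossible (A and B are disjoint)
        have hbl : (q ω).2 ≠ ℓ := by
          intro hbl
          have hσ' : σ (insert 0 (D ω)) = insert ℓ (D ω) := by
            rw [hσeq, hbl]; exact hub_symmDiff_singleton_eq_insert _ _ (hDℓ ω)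
          have hlσ : ℓ ∈ σ (insert 0 (D ω)) := by rw [hσ']; exact Finset.mem_insert_self _ _
          obtain ⟨_, hne, hBσ⟩ := hTop' _ (D ω) hFσ hlσ (by rw [hσ', Finset.erase_insert (hDℓ ω)])
          exact hAB _ hAc hBσ
        have hb1 : 1 ≤ (q ω).2 := by omega
        have hbn : (q ω).2 ≤ ℓ - 1 := by omega
        have htrail : ∀ k ∈ ω, k ≤ (q ω).2 := by
          intro k hk
          have h₁ := hubPath_le_of_mem_of_last_blue ℓ D hD ω hω hl hDn k hk
          have h₂ := (hE _ (Finset.mem_insert_of_mem ((D ω).max'_mem hDn))).2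
          omega
        have hΦω : Φ ω = ω ∪ Icc ((q ω).2 + 1) ℓ := by
          rw [hΦ, ha0, Finset.Icc_eq_empty_of_lt Nat.zero_lt_one, Finset.union_empty]
        have hwalls : D (Φ ω) = D ω ∆ {(q ω).2} := by
          rw [hΦω]; exact walls_suffix_fill ℓ D hD ω _ hb1 hbn htrail
        have h0σ : 0 ∉ σ (insert 0 (D ω)) := by
          rw [hσeq, Finset.mem_symmDiff, Finset.mem_singleton]; push Not; exact ⟨fun h => absurd h (hD0 ω), by omega⟩
        have hlσ : ℓ ∉ σ (insert 0 (D ω)) := by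
          rw [hσeq, Finset.mem_symmDiff, Finset.mem_singleton]; push Not; exact ⟨fun h => absurd h (hDℓ ω), by omega⟩
        have hRσ := hInner _ hFσ h0σ hlσ
        have h1Φ : 1 ∈ Φ ω := by rw [hΦω, Finset.mem_union]; exact Or.inl h1
        have hlΦ : ℓ ∈ Φ ω := by
          rw [hΦω, Finset.mem_union, Finset.mem_Icc]; exact Or.inr ⟨by omega, le_refl _⟩
        have hΦsub : Φ ω ⊆ Icc 1 ℓ := by
          rw [hΦω]; intro k hk
          rcases Finset.mem_union.mp hk with hk | hk
          · exact hω hk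
          · have := Finset.mem_Icc.mp hk; exact Finset.mem_Icc.mpr ⟨by omega, this.2⟩
        refine ⟨?_, ?_, by omega, hbℓ, fun k hk => by have := hωge k hk; omega, htrail⟩
        · rw [hT]
          refine ⟨hΦsub, Or.inl ⟨h1Φ, hlΦ, ?_⟩⟩
          rw [hwalls, ← hσeq]
          exact hRσ
        · rw [hemb', if_pos ⟨h1Φ, hlΦ⟩, hwalls, hσeq]
      · ---------------------------------------------------------------- BR source, E = D ω ∪ {ℓ}
        have hEeq : emb ω = insert ℓ (D ω) := by rw [hemb, if_neg h1, if_pos hl]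
        rw [hEeq] at hσ hE hσE hFσ ⊢
        obtain ⟨hDn, hBc⟩ := hB
        have hbl : (q ω).2 = ℓ := by
          have := (hE ℓ (Finset.mem_insert_self _ _)).2; omega
        -- a = 0 is impossible (A and B are disjoint)
        have ha0 : (q ω).1 ≠ 0 := by
          intro ha0
          have hσ' : σ (insert ℓ (D ω)) = insert 0 (D ω) := by
            rw [hσ, ha0, hbl, hubPath_insert_symmDiff_symmDiff_self _ _ _ (hDℓ ω) (by omega)]
            exact hub_symmDiff_singleton_eq_insert _ _ (hD0 ω)
          have h0σ : 0 ∈ σ (insert ℓ (D ω)) := by rw [hσ']; exact Finset.mem_insert_self _ _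
          obtain ⟨_, hne, hAσ⟩ := hZero' _ (D ω) hFσ h0σ (by rw [hσ', Finset.erase_insert (hD0 ω)])
          exact hAB _ hAσ hBc
        have ha1 : 1 ≤ (q ω).1 := by omega
        have han : (q ω).1 ≤ ℓ - 1 := by
          have h₂ := (hE _ (Finset.mem_insert_of_mem ((D ω).min'_mem hDn))).1
          have := hDle ω _ ((D ω).min'_mem hDn)
          omega
        have hσeq : σ (insert ℓ (D ω)) = D ω ∆ {(q ω).1} := by
          rw [hσ, hbl]; exact hubPath_insert_symmDiff_symmDiff_self _ _ _ (hDℓ ω) (by omega)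
        have hlead : ∀ k ∈ ω, (q ω).1 < k := by
          intro k hk
          have h₁ := hubPath_lt_of_mem_of_first_blue ℓ D hD ω hω h1 hDn k hk
          have h₂ := (hE _ (Finset.mem_insert_of_mem ((D ω).min'_mem hDn))).1
          omega
        have hΦω : Φ ω = ω ∪ Icc 1 (q ω).1 := by
          rw [hΦ, hbl, Finset.Icc_eq_empty_of_lt (Nat.lt_succ_self ℓ), Finset.union_empty]
        have hwalls : D (Φ ω) = D ω ∆ {(q ω).1} := by
          rw [hΦω]; exact walls_prefix_fill ℓ D hD ω _ ha1 han hlead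
        have h0σ : 0 ∉ σ (insert ℓ (D ω)) := by
          rw [hσeq, Finset.mem_symmDiff, Finset.mem_singleton]; push Not; exact ⟨fun h => absurd h (hD0 ω), by omega⟩
        have hlσ : ℓ ∉ σ (insert ℓ (D ω)) := by
          rw [hσeq, Finset.mem_symmDiff, Finset.mem_singleton]; push Not; exact ⟨fun h => absurd h (hDℓ ω), by omega⟩
        have hRσ := hInner _ hFσ h0σ hlσ
        have h1Φ : 1 ∈ Φ ω := by
          rw [hΦω, Finset.mem_union, Finset.mem_Icc]; exact Or.inr ⟨le_refl _, ha1⟩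
        have hlΦ : ℓ ∈ Φ ω := by rw [hΦω, Finset.mem_union]; exact Or.inl hl
        have hΦsub : Φ ω ⊆ Icc 1 ℓ := by
          rw [hΦω]; intro k hk
          rcases Finset.mem_union.mp hk with hk | hk
          · exact hω hk
          · have := Finset.mem_Icc.mp hk; exact Finset.mem_Icc.mpr ⟨this.1, by omega⟩
        refine ⟨?_, ?_, by omega, hbℓ, hlead, fun k hk => by have := hωle k hk; omega⟩
        · rw [hT]
          refine ⟨hΦsub, Or.inl ⟨h1Φ, hlΦ, ?_⟩⟩
          rw [hwalls, ← hσeq]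
          exact hRσ
        · rw [hemb', if_pos ⟨h1Φ, hlΦ⟩, hwalls, hσeq]
  refine ⟨Φ, fun ω hSω => ?_, fun ω ω' hSω hSω' h => ?_⟩
  · obtain ⟨hTΦ, _, hab, hb, hlead, htrail⟩ := main ω hSω
    exact ⟨hTΦ, (q ω).1, (q ω).2, hab, hb, hΦ ω, hlead, htrail⟩
  · have h1 := (main ω hSω).2.1
    have h2 := (main ω' hSω').2.1
    have hσeq : σ (emb ω) = σ (emb ω') := by rw [← h1, ← h2, h]
    exact hubPath_emb_inj ℓ hℓ D hD emb hemb ω ω' ((hS ω).mp hSω).1 ((hS ω').mp hSω').1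
      (hσinj _ _ (stepA ω hSω) (stepA ω' hSω') hσeq)

end Coefficientwise

end Summit.CriticalPhenomena.PercolationContinuityZ3.Theorems
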